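import Summits.ResolutionOfSingularities.ResolutionOfSingularities.Theorems.RadicialJungCleanModelsNSAbsorptionLoc
import Summits.ResolutionOfSingularities.ResolutionOfSingularities.Theorems.RadicialJungCleanModelsNSResidueLocAtCentre
import HarnessLib

/-!
# The POST-CHAIN step (S6): feeding ✓ `absorption_step_loc` from residue-side monomial data

Route `RadicialJung`, crux `CleanModels` (stmt-ResolutionOfSingularities-15917), registered skeleton `Cruxes/CleanModels/Lines/Sketch.lean`
rev 35 (sha16 de44649d8f729c3b), stub 7 `stub_cleanModelsDimGEFour`.  Explicit-unit seat `decomp-res-hand-2` g5 (structural hand); memo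
`Cruxes/CleanModels/Lines/Sketch-memo-hand2-g5-stubs-5-7.md` §3 (S6).  OURS; structural bookkeeping, counted 0; nothing here proves resolution of
singularities in characteristic `p`.

`absorb_of_residue_monomial` — INPUT: a finitely generated model `A ⊆ O` with model-level centre `𝔭 = (Y) · A` (`#Y ≤ dim A_𝔭`), regular residue
ring `A_𝔮/𝔭` of dimension `t`, a finite `Z` with `z = c_z · Y^{γ_z}`, `c_z ∈ A` `ν₁`-units, and RESIDUE-SIDE DATA in the ring
`ρ(locAtCentre A O) ⊆ κ(O₁)`: elements `x̄₁, …, x̄_t` of positive `ν̄`-value, non-zero, generating the centre of `ν̄` on `ρ(locAtCentre A O)`, such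
that each residue `c̄_z` is `ū_z · x̄^{δ_z}` with `ū_z` a `ν̄`-unit of `ρ(locAtCentre A O)` (the final clause of `ELU3Coord` after
✓ `chainTransport_of_isRsopPart`).  OUTPUT: the conclusion of `hMono` at `O` for `Z` — via lifts `x_i := n_i` (`x̄_i = ρ(n_i)/ρ(e_i)`),
`u_z := ℓ_z ∏ e_i^{-δ_i} ∈ locAtCentre A O`, `m_l := max_z δ_{z,l}`, and ✓ `absorption_step_loc`.
[cite: NovacoskiSpivakovsky2014, §3.2 (23)–(24)]
-/

noncomputable section

set_option linter.dupNamespace false -- mandated namespace of this single-conjunct summit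

open IsLocalRing
open Literature.AlgebraicGeometry.Resolution

namespace Summit.ResolutionOfSingularities.ResolutionOfSingularities.Theorems.RadicialJung.CleanModels

variable {k K : Type} [Field k] [Field K] [Algebra k K]

/-- **(S6) Absorption from residue-side monomial data.** See the module docstring. [cite: NovacoskiSpivakovsky2014, §3.2 (23)–(24)] -/
theorem absorb_of_residue_monomial (O O₁ : ValuationSubring K) (hO : O ≤ O₁)
    (A : Subalgebra k K) (hA : A.toSubring ≤ O.toSubring) (hAfg : A.FG) (hfrac : IsFractionRing A K)
    (Y : Finset A.toSubring)
    (hIY : ((maximalIdeal O₁).comap (Subring.inclusion (hA.trans hO))) = Ideal.span (Y : Set A.toSubring))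
    (hYcard : (Y.card : WithBot ℕ∞) ≤ ringKrullDim
      (Localization.AtPrime ((maximalIdeal O₁).comap (Subring.inclusion (hA.trans hO)))))
    (hregQ : IsRegularLocalRing
      (Localization.AtPrime ((maximalIdeal O).comap (Subring.inclusion hA)) ⧸
        ((maximalIdeal O₁).comap (Subring.inclusion (hA.trans hO))).map
          (algebraMap A.toSubring
            (Localization.AtPrime ((maximalIdeal O).comap (Subring.inclusion hA))))))
    (t : ℕ)
    (hdimt : ringKrullDim
      (Localization.AtPrime ((maximalIdeal O).comap (Subring.inclusion hA)) ⧸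
        ((maximalIdeal O₁).comap (Subring.inclusion (hA.trans hO))).map
          (algebraMap A.toSubring
            (Localization.AtPrime ((maximalIdeal O).comap (Subring.inclusion hA))))) = t)
    (xb : Fin t → ResidueField O₁)
    (hxbρ : ∀ i, xb i ∈ ((residue O₁).comp (Subring.inclusion ((locAtCentre_le hA).trans hO))).range)
    (hxb1 : ∀ i, (residueValuationSubring O O₁ hO).valuation (xb i) < 1) (hxb0 : ∀ i, xb i ≠ 0)
    (hgen : ∀ f ∈ ((residue O₁).comp (Subring.inclusion ((locAtCentre_le hA).trans hO))).range,
      (residueValuationSubring O O₁ hO).valuation f < 1 →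
      ∃ r : Fin t → ResidueField O₁, (∀ i, r i ∈ ((residue O₁).comp (Subring.inclusion ((locAtCentre_le hA).trans hO))).range) ∧
        f = ∑ i, r i * xb i)
    (Z : Finset K) (c : K → A.toSubring) (γ : K → A.toSubring → ℕ)
    (hz : ∀ z ∈ Z, z = ((c z : A.toSubring) : K) * ∏ y ∈ Y, ((y : A.toSubring) : K) ^ (γ z y))
    (hcres : ∀ z ∈ Z, ∃ (ub : ResidueField O₁) (δ : Fin t → ℕ),
      ub ∈ ((residue O₁).comp (Subring.inclusion ((locAtCentre_le hA).trans hO))).range ∧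
      (residueValuationSubring O O₁ hO).valuation ub = 1 ∧
      residue O₁ ⟨((c z : A.toSubring) : K), hO (hA (c z).2)⟩ = ub * ∏ i, xb i ^ δ i) :
    ∃ (A' : Subalgebra k K), A'.toSubring ≤ O.toSubring ∧ A ≤ A' ∧ A'.FG ∧
    ∃ (_ : IsRegularLocalRing (locAtCentre A'.toSubring O)) (e : ℕ) (a : Fin e → ↥(locAtCentre A'.toSubring O)),
      Ideal.span (Set.range a) = IsLocalRing.maximalIdeal ↥(locAtCentre A'.toSubring O) ∧
      ringKrullDim ↥(locAtCentre A'.toSubring O) = (e : WithBot ℕ∞) ∧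
      ∀ z ∈ Z, z ≠ 0 → ∃ (v : ↥(locAtCentre A'.toSubring O)) (μ : Fin e → ℕ), IsUnit v ∧
        z = (v : K) * ∏ i, ((a i : ↥(locAtCentre A'.toSubring O)) : K) ^ (μ i) := by
  classical
  haveI := hfrac
  set Ō := residueValuationSubring O O₁ hO with hŌdef
  have hAO₁ : A.toSubring ≤ O₁.toSubring := hA.trans hO
  set L := locAtCentre A.toSubring O with hLdef
  have hLO : L ≤ O.toSubring := locAtCentre_le hA
  have hLO₁ : L ≤ O₁.toSubring := hLO.trans hO
  haveI : IsLocalRing L := isLocalRing_locAtCentre hA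
  set ρ : L →+* ResidueField O₁ := (residue O₁).comp (Subring.inclusion hLO₁) with hρdef
  have hρval : ∀ ℓ : L, ρ ℓ = residue O₁ ⟨(ℓ : K), hLO₁ ℓ.2⟩ := fun _ => rfl
  -- valuation/residue helpers
  have hν₁_of_ν : ∀ y : K, O.valuation y = 1 → O₁.valuation y = 1 := by
    intro y hy
    have hyO : y ∈ O := (O.valuation_le_one_iff _).mp hy.le
    have hinvO : y⁻¹ ∈ O := (O.valuation_le_one_iff _).mp (by rw [map_inv₀, hy, inv_one])
    apply le_antisymm ((O₁.valuation_le_one_iff _).mpr (hO hyO))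
    have h1 : O₁.valuation y⁻¹ ≤ 1 := (O₁.valuation_le_one_iff _).mpr (hO hinvO)
    rw [map_inv₀] at h1
    exact (inv_le_one₀ (by rw [Valuation.pos_iff]; exact ne_zero_of_valuation_eq_one hy)).mp h1
  have hν₁_of_res_ne : ∀ (y : K) (hy : y ∈ O₁), residue O₁ ⟨y, hy⟩ ≠ 0 → O₁.valuation y = 1 := by
    intro y hy hne
    rw [Ne, residue_eq_zero_iff, ValuationSubring.valuation_lt_one_iff] at hne
    exact le_antisymm ((O₁.valuation_le_one_iff _).mpr hy) (not_lt.mp hne)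
  -- (1) lifts of the `x̄ i`: `x̄ i = ρ(ℓ i)`, `ℓ i = n i / e i`
  have hlift : ∀ i, ∃ ℓ : L, ρ ℓ = xb i := fun i => by obtain ⟨ℓ, h⟩ := hxbρ i; exact ⟨ℓ, h⟩
  choose ℓ hℓ using hlift
  have hfr : ∀ i, ∃ n e : K, n ∈ A ∧ e ∈ A ∧ O.valuation e = 1 ∧ ((ℓ i : L) : K) = n / e := fun i => by
    obtain ⟨n, hn, e, he, he1, h⟩ := (mem_locAtCentre_iff).mp (ℓ i).2
    exact ⟨n, e, hn, he, he1, h⟩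
  choose n e hnA heA he1 hℓeq using hfr
  have he0 : ∀ i, e i ≠ 0 := fun i => ne_zero_of_valuation_eq_one (he1 i)
  have heO₁ : ∀ i, e i ∈ O₁ := fun i => hO (hA (heA i))
  have hnO₁ : ∀ i, n i ∈ O₁ := fun i => hO (hA (hnA i))
  have he1' : ∀ i, O₁.valuation (e i) = 1 := fun i => hν₁_of_ν _ (he1 i)
  have heres1 : ∀ i, Ō.valuation (residue O₁ ⟨e i, heO₁ i⟩) = 1 := fun i =>
    (valuation_eq_one_iff_residue O O₁ hO (e i) (hA (heA i))).mp (he1 i)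
  have heres0 : ∀ i, residue O₁ ⟨e i, heO₁ i⟩ ≠ 0 := fun i => ne_zero_of_valuation_eq_one (heres1 i)
  -- `res (n i) = x̄ i * res (e i)`
  have hnres : ∀ i, residue O₁ ⟨n i, hnO₁ i⟩ = xb i * residue O₁ ⟨e i, heO₁ i⟩ := by
    intro i
    have : (⟨n i, hnO₁ i⟩ : O₁) = ⟨((ℓ i : L) : K), hLO₁ (ℓ i).2⟩ * ⟨e i, heO₁ i⟩ := by
      apply Subtype.ext
      change n i = ((ℓ i : L) : K) * e i
      have := he0 i
      rw [hℓeq i]; field_simp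
    rw [this, map_mul, ← hρval, hℓ i]
  let x : Fin t → A.toSubring := fun i => ⟨n i, hnA i⟩
  have hxQ : ∀ l, O.valuation ((x l : A.toSubring) : K) < 1 := by
    intro l
    change O.valuation (n l) < 1
    rw [valuation_lt_one_iff_residue O O₁ hO (n l) (hA (hnA l)), hnres l, map_mul, heres1, mul_one]
    exact hxb1 l
  have hxP : ∀ l, O₁.valuation ((x l : A.toSubring) : K) = 1 := by
    intro l
    exact hν₁_of_res_ne (n l) (hnO₁ l) (by rw [hnres l]; exact mul_ne_zero (hxb0 l) (heres0 l))
  -- (2) `𝔮 A_𝔮 = (x) + 𝔭 A_𝔮`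
  have hx𝔪 : ∀ c₀ : A.toSubring, O.valuation (c₀ : K) < 1 →
      ∃ (s : A.toSubring) (b : Fin t → A.toSubring), O.valuation (s : K) = 1 ∧
        O₁.valuation (((s * c₀ - ∑ l, b l * x l : A.toSubring)) : K) < 1 := by
    intro c₀ hc₀
    have hc₀L : (c₀ : K) ∈ L := le_locAtCentre _ _ c₀.2
    have hρc₀ : ρ ⟨c₀, hc₀L⟩ ∈ ρ.range := ⟨_, rfl⟩
    have hc₀v : Ō.valuation (ρ ⟨c₀, hc₀L⟩) < 1 := by
      rw [hρval]; exact (valuation_lt_one_iff_residue O O₁ hO (c₀ : K) (hA c₀.2)).mp hc₀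
    obtain ⟨r, hr, hsum⟩ := hgen _ hρc₀ hc₀v
    have hrl : ∀ i, ∃ ℓ' : L, ρ ℓ' = r i := fun i => by obtain ⟨ℓ', h⟩ := hr i; exact ⟨ℓ', h⟩
    choose ℓ' hℓ' using hrl
    have hfr' : ∀ i, ∃ p q : K, p ∈ A ∧ q ∈ A ∧ O.valuation q = 1 ∧ ((ℓ' i : L) : K) = p / q := fun i => by
      obtain ⟨p, hp, q, hq, hq1, h⟩ := (mem_locAtCentre_iff).mp (ℓ' i).2
      exact ⟨p, q, hp, hq, hq1, h⟩
    choose p q hpA hqA hq1 hℓ'eq using hfr'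
    have hq0 : ∀ i, q i ≠ 0 := fun i => ne_zero_of_valuation_eq_one (hq1 i)
    -- `g := c₀ - Σ ℓ' i · (n i / e i) ∈ 𝔭_L`
    have hniL : ∀ i, n i / e i ∈ L := fun i => (hℓeq i) ▸ (ℓ i).2
    let gK : K := (c₀ : K) - ∑ i, ((ℓ' i : L) : K) * (n i / e i)
    have hgL : gK ∈ L := Subring.sub_mem _ hc₀L (Subring.sum_mem _ fun i _ => Subring.mul_mem _ (ℓ' i).2 (hniL i))
    have hgO₁ : gK ∈ O₁ := hLO₁ hgL
    have hρg : residue O₁ ⟨gK, hgO₁⟩ = 0 := by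
      have hsplit : (⟨gK, hgO₁⟩ : O₁) = ⟨(c₀ : K), hLO₁ hc₀L⟩ -
          ∑ i, ⟨((ℓ' i : L) : K), hLO₁ (ℓ' i).2⟩ * ⟨n i / e i, hLO₁ (hniL i)⟩ := by
        apply Subtype.ext; push_cast; rfl
      rw [hsplit, map_sub, map_sum, sub_eq_zero]
      have h1 : residue O₁ ⟨(c₀ : K), hLO₁ hc₀L⟩ = ρ ⟨c₀, hc₀L⟩ := rfl
      rw [h1, hsum]
      refine Finset.sum_congr rfl fun i _ => ?_
      rw [map_mul]
      have h2 : residue O₁ ⟨((ℓ' i : L) : K), hLO₁ (ℓ' i).2⟩ = ρ (ℓ' i) := rfl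
      have h3 : residue O₁ ⟨n i / e i, hLO₁ (hniL i)⟩ = ρ (ℓ i) := by
        rw [hρval]; congr 1; exact Subtype.ext (hℓeq i).symm
      rw [h2, h3, hℓ', hℓ]
    have hgval : O₁.valuation gK < 1 := by
      have := hρg
      rw [residue_eq_zero_iff, ValuationSubring.valuation_lt_one_iff] at this
      exact this
    -- the common denominator `s = ∏ (q i * e i)` and `b i = p i * ∏_{j ≠ i} (q j * e j)`
    let d : Fin t → K := fun i => q i * e i
    have hdA : ∀ i, d i ∈ A := fun i => A.mul_mem (hqA i) (heA i)
    have hd1 : ∀ i, O.valuation (d i) = 1 := fun i => by simp only [d, map_mul, hq1, he1, mul_one]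
    have hd0 : ∀ i, d i ≠ 0 := fun i => ne_zero_of_valuation_eq_one (hd1 i)
    let s : A.toSubring := ⟨∏ i, d i, A.prod_mem fun i _ => hdA i⟩
    have hs1 : O.valuation (s : K) = 1 := by
      change O.valuation (∏ i, d i) = 1
      rw [map_prod]; exact Finset.prod_eq_one fun i _ => hd1 i
    let b : Fin t → A.toSubring := fun i => ⟨p i * ∏ j ∈ Finset.univ.erase i, d j,
      A.mul_mem (hpA i) (A.prod_mem fun j _ => hdA j)⟩
    refine ⟨s, b, hs1, ?_⟩
    have hK : (((s * c₀ - ∑ l, b l * x l : A.toSubring)) : K) = (s : K) * gK := by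
      push_cast
      change (∏ i, d i) * (c₀ : K) - ∑ l, (p l * ∏ j ∈ Finset.univ.erase l, d j) * n l =
        (∏ i, d i) * ((c₀ : K) - ∑ i, ((ℓ' i : L) : K) * (n i / e i))
      rw [mul_sub, Finset.mul_sum]
      congr 1
      refine Finset.sum_congr rfl fun i _ => ?_
      rw [hℓ'eq i, ← Finset.mul_prod_erase Finset.univ d (Finset.mem_univ i)]
      simp only [d]
      have := hq0 i; have := he0 i
      field_simp
    rw [hK, map_mul, hν₁_of_ν _ hs1, one_mul]
    exact hgval
  -- (3) the residue-units and exponents of the coefficients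
  have hcoef : ∀ z : K, ∃ (uz : K) (δ : Fin t → ℕ), z ∈ Z →
      uz ∈ L ∧ O.valuation uz = 1 ∧
      O₁.valuation ((1 : K) * (((c z : A.toSubring) : K) - uz * ∏ l, ((x l : A.toSubring) : K) ^ (δ l))) < 1 := by
    intro z
    by_cases hzZ : z ∈ Z
    swap
    · exact ⟨1, 0, fun h => absurd h hzZ⟩
    obtain ⟨ub, δ, hubρ, hub1, hcz⟩ := hcres z hzZ
    obtain ⟨ℓu, hℓu⟩ := hubρ
    have hℓu1 : O.valuation ((ℓu : L) : K) = 1 := by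
      rw [valuation_eq_one_iff_residue O O₁ hO _ (hLO ℓu.2), ← hρval, hℓu]; exact hub1
    -- `u_z := ℓu * ∏ (e i)^{-δ i}`
    have heinvL : ∀ i, (e i)⁻¹ ∈ L := fun i => inv_mem_locAtCentre (le_locAtCentre _ _ (heA i)) (he1 i)
    let uz : K := ((ℓu : L) : K) * ∏ i, ((e i)⁻¹) ^ δ i
    have huzL : uz ∈ L := Subring.mul_mem _ ℓu.2 (Subring.prod_mem _ fun i _ => Subring.pow_mem _ (heinvL i) _)
    have huz1 : O.valuation uz = 1 := by
      simp only [uz, map_mul, map_prod, map_pow, map_inv₀, he1, inv_one, one_pow, Finset.prod_const_one, mul_one]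
      exact hℓu1
    refine ⟨uz, δ, fun _ => ⟨huzL, huz1, ?_⟩⟩
    rw [one_mul]
    -- the residue of `c z - u_z x^δ` vanishes
    have hdiffL : ((c z : A.toSubring) : K) - uz * ∏ l, ((x l : A.toSubring) : K) ^ (δ l) ∈ L :=
      Subring.sub_mem _ (le_locAtCentre _ _ (c z).2)
        (Subring.mul_mem _ huzL (Subring.prod_mem _ fun l _ => Subring.pow_mem _ (le_locAtCentre _ _ (x l).2) _))
    have hρ0 : ρ ⟨_, hdiffL⟩ = 0 := by
      have hsplit : (⟨_, hdiffL⟩ : L) = ⟨(c z : K), le_locAtCentre _ _ (c z).2⟩ -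
          (ℓu * ∏ l, (⟨(e l)⁻¹, heinvL l⟩ * ⟨n l, le_locAtCentre _ _ (hnA l)⟩) ^ δ l) := by
        apply Subtype.ext
        push_cast
        change ((c z : A.toSubring) : K) - uz * ∏ l, n l ^ δ l = (c z : K) - (ℓu : K) * ∏ l, ((e l)⁻¹ * n l) ^ δ l
        simp only [uz, mul_pow, Finset.prod_mul_distrib, mul_assoc]
      rw [hsplit, map_sub, map_mul, map_prod, hℓu, sub_eq_zero, hρval]
      change residue O₁ ⟨((c z : A.toSubring) : K), _⟩ = _
      rw [hcz]
      congr 1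
      refine Finset.prod_congr rfl fun l _ => ?_
      rw [map_pow, map_mul, hρval, hρval]
      congr 1
      change xb l = residue O₁ ⟨(e l)⁻¹, _⟩ * residue O₁ ⟨n l, _⟩
      rw [hnres l]
      have hinv : residue O₁ ⟨(e l)⁻¹, hLO₁ (heinvL l)⟩ * residue O₁ ⟨e l, heO₁ l⟩ = 1 := by
        rw [← map_mul, ← map_one (residue O₁)]
        congr 1
        exact Subtype.ext (inv_mul_cancel₀ (he0 l))
      calc xb l = xb l * (residue O₁ ⟨(e l)⁻¹, hLO₁ (heinvL l)⟩ * residue O₁ ⟨e l, heO₁ l⟩) := by rw [hinv, mul_one]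
        _ = residue O₁ ⟨(e l)⁻¹, hLO₁ (heinvL l)⟩ * (xb l * residue O₁ ⟨e l, heO₁ l⟩) := by ring
    rw [hρval, residue_eq_zero_iff, ValuationSubring.valuation_lt_one_iff] at hρ0
    exact hρ0
  choose u δ huδ using hcoef
  let m : Fin t → ℕ := fun l => Z.sup fun z => δ z l
  have hδm : ∀ z ∈ Z, ∀ l, δ z l ≤ m l := fun z hz l => Finset.le_sup (f := fun z => δ z l) hz
  obtain ⟨A', h1, h2, h3, -, hrest⟩ := absorption_step_loc O O₁ hO A hA hAfg hfrac Y hIY hYcard hregQ t x hdimt hxQ hxP hx𝔪 Z c γ u δ m hz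
    (fun z hz => ⟨(huδ z hz).1, (huδ z hz).2.1⟩) (fun z hz => ⟨1, by simp, (huδ z hz).2.2⟩) hδm
  exact ⟨A', h1, h2, h3, hrest⟩

end Summit.ResolutionOfSingularities.ResolutionOfSingularities.Theorems.RadicialJung.CleanModels

end
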